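import Literature.NumberTheory.Transcendental.KZCalculusOver
import Literature.NumberTheory.Transcendental.KZKernelConjectureForms
import Summits.KontsevichZagierPeriods.KontsevichZagierPeriods.Statement
import Summits.KontsevichZagierPeriods.KontsevichZagierPeriods.Theorems.SoloInformedAlgebraicCoefficientDescent
import Summits.KontsevichZagierPeriods.KontsevichZagierPeriods.Theorems.SoloInformedPeriodRingOver
import HarnessLib

/-!
# SoloInformed — coefficient invariance of the KZ calculus: `KZ_k = KZ_ℚ` for real-algebraic `k`

Solo programme `solo-KontsevichZagierPeriods-informed`, session s239 (`paper/VERDICT.md` §1;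
`paper/real-parameters.md`, (S2) "`P_ℚ = P_k`").  Kontsevich–Zagier state Conjecture 1 with moves
whose "functions and domains of integration are algebraic with coefficients in `ℚ̄`" [KZ01, §1.2] and
remark that "rational" may be replaced by "algebraic" in the Definition of a period [KZ01, §1.1]; the
tree's `KontsevichZagierPeriods` fixes `ℚ`-semialgebraic data ("real algebraic coefficients are
`ℚ`-definable, so `ℚ`-semialgebraic loses nothing", docstring of `Literature.Periods.KZPeriodConjecture`).
This file makes that reading a theorem for the coefficient-generic calculus `KZCalculusOver`: for every
coefficient ring `k → ℝ` with REAL-ALGEBRAIC IMAGE (`∀ a, IsAlgebraic ℚ (algebraMap k ℝ a)`;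
hypothesis-free at `k = integralClosure ℚ ℝ`): `k`-semialgebraic data are `ℚ`-semialgebraic
(`soloInformed_isSemialgebraic_rat_of_isAlgebraic`, via `soloInformed_isSemialgebraic_rat_of_integralClosure`);
every integral representation / formal combination over `k` IS one over `ℚ` (`soloInformedRatIntegralRep`,
`soloInformedRatFormal`); base change `ℚ → k` is a bijection of `FormalRep`s carrying each move set ONTO
its `k`-version, hence `(relations ℚ).map (baseChange ℚ k) = relations k` and
`baseChange ℚ k c ∈ relations k ↔ c ∈ relations ℚ` — UNCONDITIONALLY, in contrast with `k = ℝ`, where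
the same equivalence is THEOREM T and needs the Lion–Rolin preparation fact
(`soloInformed_baseChange_mem_relations_iff_prep`); the formal period rings agree
(`soloInformedPeriodRingCoeffEquiv : P_ℚ ≃+* P_k`, compatibly with evaluation); and the summit is
coefficient-invariant: `KontsevichZagierPeriods ↔ ker (eval k) = relations k ↔ Injective (evalP : P_k → ℝ)
↔` "any two integral representations with `k`-semialgebraic data and equal values are connected by
`k`-moves" (`soloInformed_kzp_iff_forall_equivalent_of_isAlgebraic`, `…_realAlgebraic`).  No
transcendence is used: the content is "`ℝ_alg`-semialgebraic `=` `ℚ`-semialgebraic".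
References: M. Kontsevich, D. Zagier, *Periods* (2001), §§1.1–1.2; S. Basu, R. Pollack, M.-F. Roy,
*Algorithms in Real Algebraic Geometry* (2006), Thm. 2.77, Cor. 2.78; J. Cresson, J. Viu-Sos,
*On the equality of periods of Kontsevich–Zagier*, JTNB 34 (2022), §1.
-/

noncomputable section

namespace Summit.KontsevichZagierPeriods.KontsevichZagierPeriods.Theorems

open Set Literature.ModelTheory.ExponentialFields Literature.NumberTheory.Transcendental

/-! ### Descent of semialgebraic data along a coefficient map with real-algebraic image -/

section Descent

variable {k : Type*} [CommRing k] [Algebra k ℝ] (halg : ∀ a : k, IsAlgebraic ℚ (algebraMap k ℝ a))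
  {n m : ℕ}

include halg

/-- **Descent of coefficients with real-algebraic image.** If every element of `k` maps to a real
algebraic number, a `k`-semialgebraic subset of `ℝⁿ` is `ℚ`-semialgebraic: push the defining
polynomials to `(integralClosure ℚ ℝ)[X]` along the corestricted coefficient map and apply
`soloInformed_isSemialgebraic_rat_of_integralClosure`.
[Basu–Pollack–Roy 2006, Thm. 2.77, Cor. 2.78; Kontsevich–Zagier 2001, §1.1] -/
theorem soloInformed_isSemialgebraic_rat_of_isAlgebraic {s : Set (Fin n → ℝ)}
    (hs : IsSemialgebraic k s) : IsSemialgebraic ℚ s := by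
  let φ : k →+* integralClosure ℚ ℝ :=
    (algebraMap k ℝ).codRestrict (integralClosure ℚ ℝ) fun a => (halg a).isIntegral
  have hev : ∀ (p : MvPolynomial (Fin n) k) (x : Fin n → ℝ),
      MvPolynomial.aeval x (MvPolynomial.map φ p) = MvPolynomial.aeval x p := fun p x => by
    rw [MvPolynomial.aeval_def, MvPolynomial.aeval_def, MvPolynomial.eval₂_map]
    congr 1
  induction hs using BooleanSubalgebra.closure_bot_sup_induction with
  | mem t ht =>
    rcases ht with ⟨p, rfl⟩ | ⟨p, rfl⟩
    · convert soloInformed_isSemialgebraic_rat_of_integralClosure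
        (isSemialgebraic_setOf_eval_eq_zero (MvPolynomial.map φ p)) using 1
      ext x
      simp only [mem_setOf_eq, hev]
    · convert soloInformed_isSemialgebraic_rat_of_integralClosure
        (isSemialgebraic_setOf_eval_pos (MvPolynomial.map φ p)) using 1
      ext x
      simp only [mem_setOf_eq, hev]
  | bot => exact isSemialgebraic_empty
  | sup t _ u _ iht ihu => exact iht.union ihu
  | compl t _ iht => exact iht.compl

/-- Descent of coefficients for semialgebraic functions (graphs). [Basu–Pollack–Roy 2006, Cor. 2.78] -/
theorem soloInformed_isSemialgebraicFunOn_rat_of_isAlgebraic {s : Set (Fin m → ℝ)}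
    {f : (Fin m → ℝ) → ℝ} (hf : IsSemialgebraicFunOn k s f) : IsSemialgebraicFunOn ℚ s f :=
  soloInformed_isSemialgebraic_rat_of_isAlgebraic halg hf

/-- Descent of coefficients for semialgebraic maps (graphs). [Basu–Pollack–Roy 2006, Cor. 2.78] -/
theorem soloInformed_isSemialgebraicMapOn_rat_of_isAlgebraic {s : Set (Fin m → ℝ)}
    {f : (Fin m → ℝ) → (Fin n → ℝ)} (hf : IsSemialgebraicMapOn k s f) : IsSemialgebraicMapOn ℚ s f :=
  soloInformed_isSemialgebraic_rat_of_isAlgebraic halg hf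

/-- **An integral representation over `k` is one over `ℚ`** (same domain, same integrand) when `k`
has real-algebraic image. [Kontsevich–Zagier 2001, §1.1 ("rational" may be replaced by "algebraic")] -/
def soloInformedRatIntegralRep (r : KZOver.IntegralRep k n) : KZOver.IntegralRep ℚ n where
  domain := r.domain
  integrand := r.integrand
  isSemialgebraic_domain := soloInformed_isSemialgebraic_rat_of_isAlgebraic halg r.isSemialgebraic_domain
  isSemialgebraicFunOn_integrand :=
    soloInformed_isSemialgebraicFunOn_rat_of_isAlgebraic halg r.isSemialgebraicFunOn_integrand
  integrableOn := r.integrableOn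

/-- `soloInformedRatIntegralRep` keeps the value. [Kontsevich–Zagier 2001, §1.1] -/
@[simp] theorem soloInformed_value_ratIntegralRep (r : KZOver.IntegralRep k n) :
    (soloInformedRatIntegralRep halg r).value = r.value := rfl

/-- **Descent of formal combinations** `FormalRep k →+ FormalRep ℚ`, generator by generator.
[Kontsevich–Zagier 2001, §1.2] -/
def soloInformedRatFormal : KZOver.FormalRep k →+ KZOver.FormalRep ℚ :=
  FreeAbelianGroup.map fun r => ⟨r.1, soloInformedRatIntegralRep halg r.2⟩

/-- `soloInformedRatFormal` on a generator. [Kontsevich–Zagier 2001, §1.2] -/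
@[simp] theorem soloInformed_ratFormal_of (r : KZOver.IntegralRep k n) :
    soloInformedRatFormal halg (KZOver.of r) = KZOver.of (soloInformedRatIntegralRep halg r) := rfl

/-- Evaluation is unchanged by descent: `eval ℚ (ratFormal c) = eval k c`. [Kontsevich–Zagier 2001, §1.2] -/
@[simp] theorem soloInformed_eval_ratFormal (c : KZOver.FormalRep k) :
    KZOver.eval ℚ (soloInformedRatFormal halg c) = KZOver.eval k c := by
  have h : (KZOver.eval ℚ).comp (soloInformedRatFormal halg) = KZOver.eval k :=
    FreeAbelianGroup.lift_ext _ _ fun ⟨n, r⟩ => by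
      change KZOver.eval ℚ (soloInformedRatFormal halg (KZOver.of r)) = KZOver.eval k (KZOver.of r)
      rw [soloInformed_ratFormal_of, KZOver.eval_of, KZOver.eval_of, soloInformed_value_ratIntegralRep]
  exact DFunLike.congr_fun h c

end Descent

/-- The kernel form over `KZOver ℚ` is the Literature library's `KZKernelConjecture` (transport along
`KZOver.equivKZ : KZ.FormalRep ≃+ KZOver.FormalRep ℚ`). [Kontsevich–Zagier 2001, §1.2, Conjecture 1] -/
theorem soloInformed_kernelForm_rat_iff_kzKernelConjecture :
    (∀ c : KZOver.FormalRep ℚ, KZOver.eval ℚ c = 0 → c ∈ KZOver.relations ℚ) ↔ KZKernelConjecture := by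
  constructor
  · intro h c hc
    exact (KZOver.equivKZ_mem_relations_iff c).mp (h (KZOver.equivKZ c) (by rwa [KZOver.eval_equivKZ]))
  · intro h c hc
    obtain ⟨c₀, rfl⟩ := KZOver.equivKZ.surjective c
    rw [KZOver.eval_equivKZ] at hc
    exact (KZOver.equivKZ_mem_relations_iff c₀).mpr (h c₀ hc)

/-- The summit in kernel form over `KZOver ℚ`: `KontsevichZagierPeriods ↔ ker (eval ℚ) = relations ℚ`.
[Kontsevich–Zagier 2001, §1.2, Conjecture 1] -/
theorem soloInformed_kzp_iff_kernelForm_rat :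
    KontsevichZagierPeriods ↔ ∀ c : KZOver.FormalRep ℚ, KZOver.eval ℚ c = 0 → c ∈ KZOver.relations ℚ :=
  (KontsevichZagierPeriods_iff.trans kzKernelConjecture_iff_isRational.symm).trans
    soloInformed_kernelForm_rat_iff_kzKernelConjecture.symm

/-- The summit as injectivity of `evalP : P_ℚ → ℝ` on `SoloInformedPeriodRingOver ℚ`.
[Kontsevich–Zagier 2001, §1.2, Conjecture 1] -/
theorem soloInformed_kzp_iff_injective_evalPOver_rat :
    KontsevichZagierPeriods ↔ Function.Injective (soloInformedEvalPOver ℚ) :=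
  soloInformed_kzp_iff_kernelForm_rat.trans (soloInformed_injective_evalPOver_iff ℚ).symm

/-! ### Base change `ℚ → k` is an isomorphism of calculi for real-algebraic `k` -/

section Algebraic

variable {k : Type*} [CommRing k] [Algebra k ℝ] [Algebra ℚ k] [IsScalarTower ℚ k ℝ]
  (halg : ∀ a : k, IsAlgebraic ℚ (algebraMap k ℝ a)) {n m : ℕ}

include halg

/-- Base change undoes descent: `(ratIntegralRep r).baseChange k = r`. [Kontsevich–Zagier 2001, §1.1] -/
@[simp] theorem soloInformed_baseChange_ratIntegralRep (r : KZOver.IntegralRep k n) :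
    (soloInformedRatIntegralRep halg r).baseChange k = r :=
  KZOver.IntegralRep.ext rfl rfl

/-- Descent undoes base change: `ratIntegralRep (q.baseChange k) = q`. [Kontsevich–Zagier 2001, §1.1] -/
@[simp] theorem soloInformed_ratIntegralRep_baseChange (q : KZOver.IntegralRep ℚ n) :
    soloInformedRatIntegralRep halg (q.baseChange k) = q :=
  KZOver.IntegralRep.ext rfl rfl

/-- `baseChange ℚ k ∘ ratFormal = id` on `FormalRep k`. [Kontsevich–Zagier 2001, §1.2] -/
@[simp] theorem soloInformed_baseChange_ratFormal (c : KZOver.FormalRep k) :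
    KZOver.baseChange ℚ k (soloInformedRatFormal halg c) = c := by
  have h : (KZOver.baseChange ℚ k).comp (soloInformedRatFormal halg) = AddMonoidHom.id _ :=
    FreeAbelianGroup.lift_ext _ _ fun ⟨n, r⟩ => by
      change KZOver.baseChange ℚ k (soloInformedRatFormal halg (KZOver.of r)) = KZOver.of r
      rw [soloInformed_ratFormal_of, KZOver.baseChange_of, soloInformed_baseChange_ratIntegralRep]
  exact DFunLike.congr_fun h c

/-- `ratFormal ∘ baseChange ℚ k = id` on `FormalRep ℚ`. [Kontsevich–Zagier 2001, §1.2] -/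
@[simp] theorem soloInformed_ratFormal_baseChange (c : KZOver.FormalRep ℚ) :
    soloInformedRatFormal halg (KZOver.baseChange ℚ k c) = c := by
  have h : (soloInformedRatFormal halg).comp (KZOver.baseChange ℚ k) = AddMonoidHom.id _ :=
    FreeAbelianGroup.lift_ext _ _ fun ⟨n, q⟩ => by
      change soloInformedRatFormal halg (KZOver.baseChange ℚ k (KZOver.of q)) = KZOver.of q
      rw [KZOver.baseChange_of, soloInformed_ratFormal_of, soloInformed_ratIntegralRep_baseChange]
  exact DFunLike.congr_fun h c

/-- **Base change `ℚ → k` is a bijection `FormalRep ℚ → FormalRep k`** for real-algebraic `k`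
(inverse `soloInformedRatFormal`). [Kontsevich–Zagier 2001, §§1.1–1.2] -/
theorem soloInformed_baseChange_bijective_of_isAlgebraic : Function.Bijective (KZOver.baseChange ℚ k) :=
  ⟨Function.LeftInverse.injective (g := soloInformedRatFormal halg) (soloInformed_ratFormal_baseChange halg),
    Function.RightInverse.surjective (g := soloInformedRatFormal halg)
      (soloInformed_baseChange_ratFormal halg)⟩

/-- The domain-additivity moves over `k` are the base changes of those over `ℚ`. [Kontsevich–Zagier 2001, §1.2] -/
theorem soloInformed_image_baseChange_domainAddRel :
    KZOver.baseChange ℚ k '' KZOver.domainAddRel ℚ = KZOver.domainAddRel k := by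
  refine Subset.antisymm (image_subset_iff.2 fun c hc => KZOver.baseChange_mem_domainAddRel k hc) ?_
  rintro _ ⟨n, r, r₁, r₂, hdom, hnull, h₁, h₂, rfl⟩
  exact ⟨_, ⟨n, soloInformedRatIntegralRep halg r, soloInformedRatIntegralRep halg r₁,
      soloInformedRatIntegralRep halg r₂, hdom, hnull, h₁, h₂, rfl⟩,
    by simp only [map_sub, KZOver.baseChange_of, soloInformed_baseChange_ratIntegralRep]⟩

/-- The integrand-additivity moves over `k` are the base changes of those over `ℚ`. [Kontsevich–Zagier 2001, §1.2] -/
theorem soloInformed_image_baseChange_integrandAddRel :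
    KZOver.baseChange ℚ k '' KZOver.integrandAddRel ℚ = KZOver.integrandAddRel k := by
  refine Subset.antisymm (image_subset_iff.2 fun c hc => KZOver.baseChange_mem_integrandAddRel k hc) ?_
  rintro _ ⟨n, r, r₁, r₂, h₁, h₂, hadd, rfl⟩
  exact ⟨_, ⟨n, soloInformedRatIntegralRep halg r, soloInformedRatIntegralRep halg r₁,
      soloInformedRatIntegralRep halg r₂, h₁, h₂, hadd, rfl⟩,
    by simp only [map_sub, KZOver.baseChange_of, soloInformed_baseChange_ratIntegralRep]⟩

/-- The change-of-variables moves over `k` are the base changes of those over `ℚ` (a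
`k`-semialgebraic diffeomorphism is `ℚ`-semialgebraic). [Kontsevich–Zagier 2001, §1.2, rule (2)] -/
theorem soloInformed_image_baseChange_changeOfVariablesRel :
    KZOver.baseChange ℚ k '' KZOver.changeOfVariablesRel ℚ = KZOver.changeOfVariablesRel k := by
  refine Subset.antisymm
    (image_subset_iff.2 fun c hc => KZOver.baseChange_mem_changeOfVariablesRel k hc) ?_
  rintro _ ⟨n, r, r', Φ, Φ', hΦ, hΦ', hinj, hdom, hf, rfl⟩
  exact ⟨_, ⟨n, soloInformedRatIntegralRep halg r, soloInformedRatIntegralRep halg r', Φ, Φ',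
      soloInformed_isSemialgebraicMapOn_rat_of_isAlgebraic halg hΦ, hΦ', hinj, hdom, hf, rfl⟩,
    by simp only [map_sub, KZOver.baseChange_of, soloInformed_baseChange_ratIntegralRep]⟩

/-- The Newton–Leibniz moves over `k` are the base changes of those over `ℚ` (primitive and bounds
are `ℚ`-semialgebraic). [Kontsevich–Zagier 2001, §1.2, rule (3)] -/
theorem soloInformed_image_baseChange_newtonLeibnizRel :
    KZOver.baseChange ℚ k '' KZOver.newtonLeibnizRel ℚ = KZOver.newtonLeibnizRel k := by
  refine Subset.antisymm (image_subset_iff.2 fun c hc => KZOver.baseChange_mem_newtonLeibnizRel k hc) ?_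
  rintro _ ⟨n, r, r', a, b, F, hF, ha, hb, hab, hdom, hcont, hderiv, hr', rfl⟩
  exact ⟨_, ⟨n, soloInformedRatIntegralRep halg r, soloInformedRatIntegralRep halg r', a, b, F,
      soloInformed_isSemialgebraicFunOn_rat_of_isAlgebraic halg hF,
      soloInformed_isSemialgebraicFunOn_rat_of_isAlgebraic halg ha,
      soloInformed_isSemialgebraicFunOn_rat_of_isAlgebraic halg hb, hab, hdom, hcont, hderiv, hr', rfl⟩,
    by simp only [map_sub, KZOver.baseChange_of, soloInformed_baseChange_ratIntegralRep]⟩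

/-- **The relations over `k` are exactly the base changes of the relations over `ℚ`**:
`(relations ℚ).map (baseChange ℚ k) = relations k` (`≤` is `KZOver.map_baseChange_relations_le` for
every tower; equality for real-algebraic `k`). [Kontsevich–Zagier 2001, §1.2; Basu–Pollack–Roy 2006, Cor. 2.78] -/
theorem soloInformed_map_baseChange_relations_of_isAlgebraic :
    (KZOver.relations ℚ).map (KZOver.baseChange ℚ k) = KZOver.relations k := by
  rw [KZOver.relations, AddMonoidHom.map_closure, KZOver.relations]
  congr 1
  simp only [image_union, soloInformed_image_baseChange_domainAddRel halg,
    soloInformed_image_baseChange_integrandAddRel halg,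
    soloInformed_image_baseChange_changeOfVariablesRel halg,
    soloInformed_image_baseChange_newtonLeibnizRel halg]

/-- **`KZ_k` is conservative and surjective over `KZ_ℚ`, unconditionally** (real-algebraic `k`):
`baseChange ℚ k c ∈ relations k ↔ c ∈ relations ℚ`.  Contrast `k = ℝ`, where `→` is THEOREM T
(`soloInformed_baseChange_mem_relations_iff_prep`, granting the Lion–Rolin preparation fact).
[Kontsevich–Zagier 2001, §§1.1–1.2; Basu–Pollack–Roy 2006, Cor. 2.78] -/
theorem soloInformed_baseChange_mem_relations_iff_of_isAlgebraic (c : KZOver.FormalRep ℚ) :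
    KZOver.baseChange ℚ k c ∈ KZOver.relations k ↔ c ∈ KZOver.relations ℚ := by
  rw [← soloInformed_map_baseChange_relations_of_isAlgebraic halg]
  constructor
  · rintro ⟨c', hc', h⟩
    rwa [← (soloInformed_baseChange_bijective_of_isAlgebraic halg).1 h]
  · exact fun hc => AddSubgroup.mem_map_of_mem _ hc

/-- Descent form: `ratFormal c ∈ relations ℚ ↔ c ∈ relations k`. [Kontsevich–Zagier 2001, §1.2] -/
theorem soloInformed_ratFormal_mem_relations_iff (c : KZOver.FormalRep k) :
    soloInformedRatFormal halg c ∈ KZOver.relations ℚ ↔ c ∈ KZOver.relations k := by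
  rw [← soloInformed_baseChange_mem_relations_iff_of_isAlgebraic halg, soloInformed_baseChange_ratFormal]

/-- Equivalence of `ℚ`-representations is the same over `k` as over `ℚ`. [Kontsevich–Zagier 2001, §1.2] -/
theorem soloInformed_equivalent_baseChange_iff_of_isAlgebraic
    (q : KZOver.IntegralRep ℚ n) (q' : KZOver.IntegralRep ℚ m) :
    KZOver.Equivalent (q.baseChange k) (q'.baseChange k) ↔ KZOver.Equivalent q q' := by
  rw [KZOver.Equivalent, KZOver.Equivalent, ← soloInformed_baseChange_mem_relations_iff_of_isAlgebraic halg,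
    map_sub, KZOver.baseChange_of, KZOver.baseChange_of]

/-- **Conjecture 1 in kernel form is coefficient-invariant**: `ker (eval k) = relations k` iff
`ker (eval ℚ) = relations ℚ` (real-algebraic `k`). [Kontsevich–Zagier 2001, §1.2, Conjecture 1] -/
theorem soloInformed_kernelForm_iff_of_isAlgebraic :
    (∀ c : KZOver.FormalRep k, KZOver.eval k c = 0 → c ∈ KZOver.relations k) ↔
      ∀ c : KZOver.FormalRep ℚ, KZOver.eval ℚ c = 0 → c ∈ KZOver.relations ℚ := by
  constructor
  · intro h c hc
    refine (soloInformed_baseChange_mem_relations_iff_of_isAlgebraic halg c).mp (h _ ?_)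
    rw [KZOver.eval_baseChange, hc]
  · intro h c hc
    refine (soloInformed_ratFormal_mem_relations_iff halg c).mp (h _ ?_)
    rw [soloInformed_eval_ratFormal, hc]

/-- `P_ℚ →+* P_k` is injective (real-algebraic `k`). [Kontsevich–Zagier 2001, §1.2] -/
theorem soloInformed_periodRingBaseChange_injective_of_isAlgebraic :
    Function.Injective (soloInformedPeriodRingBaseChange ℚ k) := by
  rw [injective_iff_map_eq_zero]
  intro x hx
  obtain ⟨c, rfl⟩ := soloInformed_toPeriodOver_surjective ℚ x
  rw [soloInformed_periodRingBaseChange_toPeriodOver, soloInformed_toPeriodOver_eq_zero_iff,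
    soloInformed_baseChange_mem_relations_iff_of_isAlgebraic halg] at hx
  exact soloInformed_toPeriodOver_eq_zero_iff.mpr hx

/-- `P_ℚ →+* P_k` is surjective (real-algebraic `k`). [Kontsevich–Zagier 2001, §1.2] -/
theorem soloInformed_periodRingBaseChange_surjective_of_isAlgebraic :
    Function.Surjective (soloInformedPeriodRingBaseChange ℚ k) := by
  intro y
  obtain ⟨c, rfl⟩ := soloInformed_toPeriodOver_surjective k y
  exact ⟨soloInformedToPeriodOver ℚ (soloInformedRatFormal halg c), by
    rw [soloInformed_periodRingBaseChange_toPeriodOver, soloInformed_baseChange_ratFormal]⟩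

/-- **The formal period rings agree: `P_ℚ ≃+* P_k`** for every coefficient ring `k` with
real-algebraic image — the isomorphism `⟦c⟧ ↦ ⟦baseChange ℚ k c⟧` (`paper/real-parameters.md`, (S2)).
[Kontsevich–Zagier 2001, §§1.1–1.2; Basu–Pollack–Roy 2006, Cor. 2.78] -/
def soloInformedPeriodRingCoeffEquiv : SoloInformedPeriodRingOver ℚ ≃+* SoloInformedPeriodRingOver k :=
  RingEquiv.ofBijective (soloInformedPeriodRingBaseChange ℚ k)
    ⟨soloInformed_periodRingBaseChange_injective_of_isAlgebraic halg,
      soloInformed_periodRingBaseChange_surjective_of_isAlgebraic halg⟩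

/-- The isomorphism `P_ℚ ≃+* P_k` commutes with evaluation. [Kontsevich–Zagier 2001, §1.2] -/
@[simp] theorem soloInformed_evalPOver_periodRingCoeffEquiv (x : SoloInformedPeriodRingOver ℚ) :
    soloInformedEvalPOver k (soloInformedPeriodRingCoeffEquiv halg x) = soloInformedEvalPOver ℚ x :=
  soloInformed_evalPOver_baseChange x

/-- **Injectivity of `evalP` is coefficient-invariant**: `evalP : P_k → ℝ` is injective iff
`evalP : P_ℚ → ℝ` is (real-algebraic `k`). [Kontsevich–Zagier 2001, §1.2, Conjecture 1] -/
theorem soloInformed_injective_evalPOver_iff_of_isAlgebraic :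
    Function.Injective (soloInformedEvalPOver k) ↔ Function.Injective (soloInformedEvalPOver ℚ) := by
  rw [soloInformed_injective_evalPOver_iff, soloInformed_injective_evalPOver_iff]
  exact soloInformed_kernelForm_iff_of_isAlgebraic halg

/-- **KZ's Conjecture 1 is insensitive to real-algebraic coefficients (kernel form)**:
`KontsevichZagierPeriods ↔ ker (eval k) = relations k`. [Kontsevich–Zagier 2001, §§1.1–1.2, Conjecture 1] -/
theorem soloInformed_kzp_iff_kernelForm_of_isAlgebraic :
    KontsevichZagierPeriods ↔ ∀ c : KZOver.FormalRep k, KZOver.eval k c = 0 → c ∈ KZOver.relations k :=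
  soloInformed_kzp_iff_kernelForm_rat.trans (soloInformed_kernelForm_iff_of_isAlgebraic halg).symm

/-- **KZ's Conjecture 1 is insensitive to real-algebraic coefficients (ring form)**:
`KontsevichZagierPeriods ↔ Injective (evalP : P_k → ℝ)`. [Kontsevich–Zagier 2001, §§1.1–1.2, Conjecture 1] -/
theorem soloInformed_kzp_iff_injective_evalPOver_of_isAlgebraic :
    KontsevichZagierPeriods ↔ Function.Injective (soloInformedEvalPOver k) :=
  soloInformed_kzp_iff_injective_evalPOver_rat.trans
    (soloInformed_injective_evalPOver_iff_of_isAlgebraic halg).symm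

/-- **KZ's Conjecture 1 is insensitive to real-algebraic coefficients (two-representation form)**:
the summit holds iff ANY two integral representations with `k`-semialgebraic domain and integrand
and equal values are connected by finitely many moves with `k`-semialgebraic data — Conjecture 1 as
printed ("algebraic with coefficients in `ℚ̄`" [KZ01, §1.2]) for real-algebraic `k`.
[Kontsevich–Zagier 2001, §§1.1–1.2, Conjecture 1] -/
theorem soloInformed_kzp_iff_forall_equivalent_of_isAlgebraic :
    KontsevichZagierPeriods ↔
      ∀ ⦃n m : ℕ⦄ (r : KZOver.IntegralRep k n) (r' : KZOver.IntegralRep k m),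
        r.value = r'.value → KZOver.Equivalent r r' := by
  have hS : KontsevichZagierPeriods ↔ KZKernelConjecture :=
    KontsevichZagierPeriods_iff.trans kzKernelConjecture_iff_isRational.symm
  constructor
  · rw [soloInformed_kzp_iff_kernelForm_of_isAlgebraic halg]
    intro h n m r r' hv
    apply h
    rw [map_sub, KZOver.eval_of, KZOver.eval_of, hv, sub_self]
  · rw [hS, kzKernelConjecture_iff_kzPeriodConjecture']
    intro h n m r r' hv
    have hE := h ((KZOver.IntegralRep.ofKZ r).baseChange k) ((KZOver.IntegralRep.ofKZ r').baseChange k) hv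
    rwa [soloInformed_equivalent_baseChange_iff_of_isAlgebraic halg, KZOver.equivalent_ofKZ_iff] at hE

end Algebraic

section RealAlgebraic

/-- Every element of `integralClosure ℚ ℝ` is algebraic over `ℚ`. [folklore] -/
theorem soloInformed_isAlgebraic_of_integralClosure (a : integralClosure ℚ ℝ) :
    IsAlgebraic ℚ (algebraMap (integralClosure ℚ ℝ) ℝ a) :=
  a.2.isAlgebraic

/-- **`KZ_{ℝ_alg} = KZ_ℚ` on relations**: `baseChange ℚ ℝ_alg c ∈ relations ℝ_alg ↔ c ∈ relations ℚ`.
[Kontsevich–Zagier 2001, §§1.1–1.2; Basu–Pollack–Roy 2006, Cor. 2.78] -/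
theorem soloInformed_baseChange_mem_relations_iff_realAlgebraic (c : KZOver.FormalRep ℚ) :
    KZOver.baseChange ℚ (integralClosure ℚ ℝ) c ∈ KZOver.relations (integralClosure ℚ ℝ) ↔
      c ∈ KZOver.relations ℚ :=
  soloInformed_baseChange_mem_relations_iff_of_isAlgebraic soloInformed_isAlgebraic_of_integralClosure c

/-- **The summit with real-algebraic coefficients, kernel form** (hypothesis-free):
`KontsevichZagierPeriods ↔ ker (eval ℝ_alg) = relations ℝ_alg`. [Kontsevich–Zagier 2001, §1.2, Conjecture 1] -/
theorem soloInformed_kzp_iff_kernelForm_realAlgebraic :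
    KontsevichZagierPeriods ↔
      ∀ c : KZOver.FormalRep (integralClosure ℚ ℝ), KZOver.eval (integralClosure ℚ ℝ) c = 0 →
        c ∈ KZOver.relations (integralClosure ℚ ℝ) :=
  soloInformed_kzp_iff_kernelForm_of_isAlgebraic soloInformed_isAlgebraic_of_integralClosure

/-- **The summit with real-algebraic coefficients, ring form** (hypothesis-free):
`KontsevichZagierPeriods ↔ Injective (evalP : P_{ℝ_alg} → ℝ)`. [Kontsevich–Zagier 2001, §1.2, Conjecture 1] -/
theorem soloInformed_kzp_iff_injective_evalPOver_realAlgebraic :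
    KontsevichZagierPeriods ↔ Function.Injective (soloInformedEvalPOver (integralClosure ℚ ℝ)) :=
  soloInformed_kzp_iff_injective_evalPOver_of_isAlgebraic soloInformed_isAlgebraic_of_integralClosure

/-- **The summit with real-algebraic coefficients, as printed** (hypothesis-free): the tree's
`ℚ`-statement holds iff any two absolutely convergent integrals of `ℝ_alg`-semialgebraic functions
over `ℝ_alg`-semialgebraic domains with the same value are connected by rules 1), 2), 3) with
`ℝ_alg`-semialgebraic data. [Kontsevich–Zagier 2001, §§1.1–1.2, Conjecture 1] -/
theorem soloInformed_kzp_iff_forall_equivalent_realAlgebraic :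
    KontsevichZagierPeriods ↔
      ∀ ⦃n m : ℕ⦄ (r : KZOver.IntegralRep (integralClosure ℚ ℝ) n)
        (r' : KZOver.IntegralRep (integralClosure ℚ ℝ) m),
        r.value = r'.value → KZOver.Equivalent r r' :=
  soloInformed_kzp_iff_forall_equivalent_of_isAlgebraic soloInformed_isAlgebraic_of_integralClosure

end RealAlgebraic

end Summit.KontsevichZagierPeriods.KontsevichZagierPeriods.Theorems
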